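import Summits.FinalStateConjecture.FinalStateConjecture.Theorems.PhotonSphereChannelsChannelsResolveTameDevelopmentsRKerrDocTransfer
import Literature.Geometry.Lorentzian.KerrKillingAlgebraProofs
import Literature.Geometry.Lorentzian.KerrStationaryBlackHole
import Literature.Geometry.Lorentzian.KerrDataProofs
import Literature.Geometry.Lorentzian.KerrSurfaceGravity
import Literature.Geometry.Lorentzian.CompleteIsometricImmersionOnto
import Literature.Geometry.Lorentzian.EinsteinTensorNaturality
import Literature.Geometry.Lorentzian.DocStationarySpacetime
import HarnessLib

/-!
# Route PhotonSphereChannels · crux `ChannelsResolveTameDevelopmentsR` (K2R-T2, stmt-FinalStateConjecture-17430) —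
# two exact Kerr charts of one region: the transition isometry and the FIRST parameter relation `M/r₊ = M'/r₊'`

Input (U) `DarkFuture.KerrDocParamUniqueOn` of the reductions of stubs K (`…RKerrLocusReduction.lean`) and K♭
(`…RKerrParametersConstantAlong.lean`, `…RKerrDocSpinFlip.lean`) of the lines `dark-future-exactness` /
`tame-lasalle-dock` says: the sub-extremal Kerr parameters of a region `O ⊆ 𝓢` are unique up to the sign of `a`. Two
exact charts `Ψ : Kerr.exterior M a → O`, `Ψ' : Kerr.exterior M' a' → O` (`TameHull.IsKerrDoc`) give the transition map
`φ = Ψ'⁻¹ ∘ Ψ`, an ISOMETRY between the two Kerr exteriors; this file builds `φ` and extracts the first of the two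
relations between `(M, a)` and `(M', a')` that an isometry forces, by the Killing algebra of Kerr (O'Neill 1995,
Cor. 3.7.4, PROVED in the tree: `ONeill1995_kerrKillingFields_holds`):

* §1 `g_{M,a}(α∂_{t*}, α∂_{t*}) = α²(−1 + 2H)` and the range of the Kerr–Schild scalar `H = Mr³/(r⁴ + a²z²)` on the exterior:
  `0 < H < M/r₊`, with `M/r₊` and `0` approached (equatorial points, `H = M/r`, `r → r₊⁺` resp. `r → ∞`).
* §2 The far-field growth of `g(α∂_{t*} + β∂_φ, ·)` for `β ≠ 0` (it exceeds every bound at far equatorial points;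
  `kerr_killingCombination_spacelike_far` of `…StubKerrIsometryRigidity` pushed to an arbitrary level), hence:
  **a Killing field of the rotating sub-extremal Kerr exterior whose norm is bounded above is `α ∂_{t*}`**
  (`killingField_eq_smul_of_norm_le`; O'Neill's Cor. 3.7.4 + far field).
* §3 The transition map of two exact charts of one region (`exists_kerrChart_transition`): bijective, `C^∞`
  (`DarkFuture.contMDiff_of_comp_isLocalDiffeomorph`, the second chart being an equidimensional isometric immersion,
  hence a local diffeomorphism) and an isometric immersion `g_{M,a} → g_{M',a'}` (chain rule for pullbacks).
* §4 Along an isometric immersion `φ` of Kerr exteriors ONTO, the pulled-back stationary field `φ^* ∂_{t*}'` is a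
  Killing field of `g_{M,a}` (`IsKillingField.comap_mpullback`) of norm `−1 + 2H' ∘ φ ≤ −1 + 2M'/r₊'`, so for `a ≠ 0`
  it is `α ∂_{t*}` (§2); comparing infima of the norms gives `α² = 1`, comparing suprema gives
  **`M/r₊ = M'/r₊'`** (`div_rPlus_eq_of_isIsometricImmersion`, `div_rPlus_eq_of_isKerrDoc`).

The second relation (`M²/r₊⁶ = M'²/r₊'⁶`, supremum of the Kretschmann scalar) and the assembly of (U) are in the
companion `…RKerrDocParamUnique.lean`. All results proved; no definitions.

References: B. O'Neill, *The Geometry of Kerr Black Holes* (1995), Ch. 2 §2.4 p. 66 (2), Ch. 3 §3.7 Cor. 3.7.4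
[ONeill1995]; B. O'Neill, *Semi-Riemannian Geometry* (1983), Ch. 3 pp. 58, 90–91, Ch. 9 Prop. 9.25 [ONeill1983];
M. Visser, arXiv:0706.0622, (32)–(35) [arXiv07060622]; Dafermos–Luk 2017, Conjecture 1 [DafermosLuk2017].
-/

noncomputable section

-- the operator-norm instance on `E4 →L[ℝ] E4 →L[ℝ] ℝ` needs one more level of pending
-- instance problems than the default (as in `PhotonSphereChannelsTameHullDefs.lean`)
set_option maxSynthPendingDepth 3
-- every `Summit.FinalStateConjecture.FinalStateConjecture.…` name repeats the summit = sub-problem segment (D-0017 layout)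
set_option linter.dupNamespace false

open Set Filter Function TopologicalSpace Manifold Bundle
open scoped Topology Manifold ContDiff ENNReal NNReal

namespace Summit.FinalStateConjecture.FinalStateConjecture.Theorems.TameLaSalle

open Literature.Geometry.Lorentzian Literature.Barriers.FinalStateConjecture
open Summit.FinalStateConjecture.FinalStateConjecture.Theorems.TameHull
open Summit.FinalStateConjecture.FinalStateConjecture.Theorems.DarkFuture

/-! ### §1 The norm of `∂_{t*}` and the range of the Kerr–Schild scalar `H` on the exterior -/

/-- `g_{M,a}(α∂_{t*}, α∂_{t*}) = α²(−1 + 2H)` at a chart point (`α∂_{t*} = K_{α,0}`; `η(K, K) = −α²`, `ℓ(K) = α`).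
[cite: arXiv07060622, (32)–(34)] -/
theorem kerrSchild_gtt_smul (M a α : ℝ) {r₀ : ℝ} (x : Kerr.region a r₀) :
    Kerr.bilin M a x.1 (α • E4.basisVector 0) (α • E4.basisVector 0) = α ^ 2 * (-1 + 2 * Kerr.scalarH M a x.1) := by
  have hK : (α • E4.basisVector 0 : E4) = killingCombination a r₀ α 0 x := by
    simp [killingCombination]
  rw [hK, Kerr.bilin_apply, minkowski_killingCombination, nullCovector_killingCombination]
  ring

/-- **`H < M/r₊` on the exterior** (`H ≤ M/r` and `r > r₊ > 0`). [cite: arXiv07060622, (33)] -/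
theorem scalarH_lt_div_rPlus {M a : ℝ} (hM : 0 < M) {x : E4} (hx : x ∈ Kerr.region a (Kerr.rPlus M a)) :
    Kerr.scalarH M a x < M / Kerr.rPlus M a := by
  have hr : Kerr.rPlus M a < Kerr.radius a x := Kerr.lt_radius_of_mem_region hx
  have hrp := Kerr.rPlus_pos hM a
  exact (Kerr.scalarH_le_div hM.le a (hrp.trans hr)).trans_lt (div_lt_div_of_pos_left hM hrp hr)

/-- **`M/r₊` is approached by `H` on the exterior**: for every `ε > 0` there is an (equatorial) exterior point with
`H > M/r₊ − ε` (there `H = M/r`, and `r → r₊⁺`). [cite: arXiv07060622, (33)] -/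
theorem exists_mem_exterior_lt_scalarH {M a : ℝ} (hM : 0 < M) {ε : ℝ} (hε : 0 < ε) :
    ∃ x : E4, x ∈ Kerr.region a (Kerr.rPlus M a) ∧ M / Kerr.rPlus M a - ε < Kerr.scalarH M a x := by
  have hrp := Kerr.rPlus_pos hM a
  have hcont : Tendsto (fun r : ℝ ↦ M / r) (𝓝[>] Kerr.rPlus M a) (𝓝 (M / Kerr.rPlus M a)) :=
    (tendsto_const_nhds.div tendsto_id hrp.ne').mono_left nhdsWithin_le_nhds
  have h1 : ∀ᶠ r in 𝓝[>] Kerr.rPlus M a, M / Kerr.rPlus M a - ε < M / r :=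
    hcont.eventually (lt_mem_nhds (by linarith))
  obtain ⟨r, hr1, hr2⟩ := (h1.and eventually_mem_nhdsWithin).exists
  have hr2' : Kerr.rPlus M a < r := hr2
  have hr0 : 0 < r := hrp.trans hr2'
  refine ⟨equatorialPoint √(r ^ 2 + a ^ 2), ?_, ?_⟩
  · rw [Kerr.mem_region, radius_equatorialPoint hr0]
    exact max_lt hr2' hr0
  · rwa [scalarH_equatorialPoint hr0]

/-- **`0` is approached by `H` on the exterior**: for every `ε > 0` there is an (equatorial) exterior point with
`H < ε` (`H = M/r`, `r → ∞`). [cite: arXiv07060622, (33)] -/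
theorem exists_mem_exterior_scalarH_lt {M a : ℝ} (hM : 0 < M) {ε : ℝ} (hε : 0 < ε) :
    ∃ x : E4, x ∈ Kerr.region a (Kerr.rPlus M a) ∧ Kerr.scalarH M a x < ε := by
  set r : ℝ := max (Kerr.rPlus M a) 0 + M / ε + 1 with hr_def
  have hq : 0 < M / ε := div_pos hM hε
  have hr0 : max (Kerr.rPlus M a) 0 < r := by rw [hr_def]; linarith
  have hr : 0 < r := lt_of_le_of_lt (le_max_right _ _) hr0
  refine ⟨equatorialPoint √(r ^ 2 + a ^ 2), ?_, ?_⟩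
  · rw [Kerr.mem_region, radius_equatorialPoint hr]
    exact hr0
  · rw [scalarH_equatorialPoint hr, div_lt_iff₀ hr]
    have h1 : M / ε < r := by rw [hr_def]; linarith [le_max_right (Kerr.rPlus M a) 0]
    calc M = ε * (M / ε) := by field_simp
      _ < ε * r := mul_lt_mul_of_pos_left h1 hε

/-! ### §2 Far-field growth of `α ∂_{t*} + β ∂_φ`; bounded Killing fields of rotating Kerr are multiples of `∂_{t*}` -/

/-- **`g(α ∂_{t*} + β ∂_φ, ·)` exceeds every bound on the exterior when `β ≠ 0`** (`M ≥ 0`): at the equatorial point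
`(0, √(r² + a²), 0, 0)`, `g(K, K) = −α² + β²(r² + a²) + 2Hℓ(K)² ≥ −α² + β²r²`, and `r` is taken beyond
`max r₊ 0 + 1 + (α² + |B|)/β²`. Adapted from `kerr_killingCombination_spacelike_far` (the bound `0` replaced by `B`).
O'Neill 1995, Ch. 2, p. 66, (2) ("`⟨X, X⟩ → +∞` unless `B = 0`"). [cite: ONeill1995, Ch. 2 §2.4, p. 66 (2)] -/
theorem exists_lt_bilin_killingCombination {M a : ℝ} (hM : 0 ≤ M) (α : ℝ) {β : ℝ} (hβ : β ≠ 0) (B : ℝ) :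
    ∃ x : Kerr.region a (Kerr.rPlus M a),
      B < Kerr.bilin M a x.1 (killingCombination a _ α β x) (killingCombination a _ α β x) := by
  -- adapted from `kerr_killingCombination_spacelike_far` (…StationaryLimitReductionStubKerrIsometryRigidity)
  have hβ2 : 0 < β ^ 2 := by positivity
  set r : ℝ := max (Kerr.rPlus M a) 0 + 2 + (α ^ 2 + |B|) / β ^ 2 with hr_def
  have hq : 0 ≤ (α ^ 2 + |B|) / β ^ 2 := by positivity
  have hr0 : max (Kerr.rPlus M a) 0 < r := by rw [hr_def]; linarith
  have hr1 : 1 ≤ r := by rw [hr_def]; linarith [le_max_right (Kerr.rPlus M a) 0]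
  have hr : 0 < r := by linarith
  have hmem : equatorialPoint √(r ^ 2 + a ^ 2) ∈ Kerr.region a (Kerr.rPlus M a) := by
    rw [Kerr.mem_region, radius_equatorialPoint hr]
    exact hr0
  refine ⟨(⟨equatorialPoint √(r ^ 2 + a ^ 2), hmem⟩ : Kerr.region a (Kerr.rPlus M a)), ?_⟩
  change B < Kerr.bilin M a (equatorialPoint √(r ^ 2 + a ^ 2)) _ _
  rw [Kerr.bilin_apply, minkowski_killingCombination_equatorialPoint, Real.sq_sqrt (by positivity)]
  have hH : 0 ≤ Kerr.scalarH M a (equatorialPoint √(r ^ 2 + a ^ 2)) := Kerr.scalarH_nonneg hM a _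
  have hℓ : 0 ≤ Kerr.nullCovector a (equatorialPoint √(r ^ 2 + a ^ 2))
        (killingCombination a _ α β ⟨equatorialPoint √(r ^ 2 + a ^ 2), hmem⟩) *
      Kerr.nullCovector a (equatorialPoint √(r ^ 2 + a ^ 2))
        (killingCombination a _ α β ⟨equatorialPoint √(r ^ 2 + a ^ 2), hmem⟩) :=
    mul_self_nonneg _
  have h1 : α ^ 2 + |B| < β ^ 2 * (r - 1) := by
    have h : (α ^ 2 + |B|) / β ^ 2 < r - 1 := by rw [hr_def]; linarith [le_max_right (Kerr.rPlus M a) 0]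
    rw [div_lt_iff₀ hβ2] at h
    linarith
  have h2 : β ^ 2 * (r - 1) ≤ β ^ 2 * r ^ 2 :=
    mul_le_mul_of_nonneg_left (by nlinarith [sq_nonneg (r - 1)]) hβ2.le
  nlinarith [mul_nonneg (mul_nonneg (by norm_num : (0 : ℝ) ≤ 2) hH) hℓ, le_abs_self B,
    mul_nonneg hβ2.le (sq_nonneg a)]

/-- **A Killing field of the rotating sub-extremal Kerr exterior whose norm is bounded above is a constant multiple of
`∂_{t*}`**: by O'Neill's Cor. 3.7.4 (`ONeill1995_kerrKillingFields_holds`) it is `α ∂_{t*} + β ∂_φ`, and `β = 0` by the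
far-field growth `exists_lt_bilin_killingCombination`. O'Neill 1995, Ch. 2, p. 66, (2) with Ch. 3, Cor. 3.7.4.
[cite: ONeill1995, Ch. 3 §3.7, Cor. 3.7.4] -/
theorem killingField_eq_smul_of_norm_le [Kerr.Facts] {M a : ℝ} [(Kerr.smoothMetric M a (Kerr.rPlus M a)).HasLeviCivita]
    (ha : a ≠ 0) (hMa : Kerr.IsSubextremal M a) {X : Π x : Kerr.region a (Kerr.rPlus M a), TangentSpace 𝓘(ℝ, E4) x}
    (hX : (Kerr.smoothMetric M a (Kerr.rPlus M a)).toPseudoRiemannianMetric.IsKillingField X) {B : ℝ}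
    (hB : ∀ x : Kerr.region a (Kerr.rPlus M a), (Kerr.smoothMetric M a (Kerr.rPlus M a)).val x (X x) (X x) ≤ B) :
    ∃ α : ℝ, ∀ x : Kerr.region a (Kerr.rPlus M a), X x = α • E4.basisVector 0 := by
  obtain ⟨α, β, hαβ⟩ := ONeill1995_kerrKillingFields_holds M a ha hMa X hX
  have hβ : β = 0 := by
    by_contra hβ
    obtain ⟨x, hx⟩ := exists_lt_bilin_killingCombination hMa.pos.le α hβ B
    have h1 := hB x
    rw [hαβ x, ← killingCombination_apply, Kerr.smoothMetric_val] at h1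
    exact absurd (hx.trans_le h1) (lt_irrefl _)
  refine ⟨α, fun x ↦ ?_⟩
  rw [hαβ x, hβ, zero_smul, add_zero]
  rfl

/-! ### §3 The transition map of two exact Kerr charts of one region -/

section Transition

variable {𝓢 : Spacetime.{0} 4}

/-- **An exact Kerr chart is an isometric immersion of the smooth Kerr metric** (`Ψ^* g = g_{M,a}` is the vanishing of
`Spacetime.deviation` for `Kerr.background M a`). [cite: ONeill1983, Ch. 3, p. 58] -/
theorem isIsometricImmersion_of_deviation_eq_zero [Kerr.Facts] {M a : ℝ}
    {Ψ : Kerr.region a (Kerr.rPlus M a) → 𝓢.carrier}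
    (hsmooth : ContMDiff 𝓘(ℝ, E4) (𝓡 4) ∞ Ψ) (hdev : ∀ x, 𝓢.deviation (Kerr.background M a) Ψ x = 0) :
    PseudoRiemannianMetric.IsIsometricImmersion (Kerr.smoothMetric M a (Kerr.rPlus M a)).toPseudoRiemannianMetric
      𝓢.metric.toPseudoRiemannianMetric Ψ := by
  refine ⟨hsmooth, fun z ↦ ?_⟩
  have h := hdev z
  rw [Spacetime.deviation, sub_eq_zero] at h
  exact h

/-- **The transition map of two exact Kerr charts of one region.** If `Ψ : Kerr.exterior M a → 𝓢` and
`Ψ' : Kerr.exterior M' a' → 𝓢` are injective `C^∞` maps with the SAME range pulling `g` back exactly to `g_{M,a}` resp.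
`g_{M',a'}`, then `φ := Ψ'⁻¹ ∘ Ψ` is a bijection of the exteriors with `Ψ' ∘ φ = Ψ`, `C^∞` (`Ψ'` is an equidimensional
isometric immersion, hence an injective local diffeomorphism, and `Ψ' ∘ φ = Ψ` is `C^∞`:
`contMDiff_of_comp_isLocalDiffeomorph`), and an isometric immersion `g_{M,a} → g_{M',a'}`
(`φ^* g_{M',a'} = φ^* Ψ'^* g = (Ψ' ∘ φ)^* g = Ψ^* g = g_{M,a}`, `pullbackBilin_comp`). O'Neill 1983, Ch. 3, pp. 58, 90–91.
[cite: ONeill1983, Ch. 3, pp. 90–91] -/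
theorem exists_kerrChart_transition [Kerr.Facts] {M a M' a' : ℝ} {Ψ : Kerr.region a (Kerr.rPlus M a) → 𝓢.carrier}
    (hinj : Injective Ψ) (hsmooth : ContMDiff 𝓘(ℝ, E4) (𝓡 4) ∞ Ψ)
    (hdev : ∀ x, 𝓢.deviation (Kerr.background M a) Ψ x = 0) {Ψ' : Kerr.region a' (Kerr.rPlus M' a') → 𝓢.carrier}
    (hinj' : Injective Ψ') (hsmooth' : ContMDiff 𝓘(ℝ, E4) (𝓡 4) ∞ Ψ')
    (hdev' : ∀ x, 𝓢.deviation (Kerr.background M' a') Ψ' x = 0) (hrange : range Ψ = range Ψ') :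
    ∃ φ : Kerr.region a (Kerr.rPlus M a) → Kerr.region a' (Kerr.rPlus M' a'),
      Bijective φ ∧ (∀ x, Ψ' (φ x) = Ψ x) ∧
        PseudoRiemannianMetric.IsIsometricImmersion (Kerr.smoothMetric M a (Kerr.rPlus M a)).toPseudoRiemannianMetric
          (Kerr.smoothMetric M' a' (Kerr.rPlus M' a')).toPseudoRiemannianMetric φ := by
  have hmem : ∀ x, Ψ x ∈ range Ψ' := fun x ↦ by rw [← hrange]; exact mem_range_self x
  choose φ hφ using hmem
  have hmem' : ∀ y, Ψ' y ∈ range Ψ := fun y ↦ by rw [hrange]; exact mem_range_self y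
  choose φ' hφ' using hmem'
  have h1 : ∀ x, φ' (φ x) = x := fun x ↦ hinj (by rw [hφ', hφ])
  have h2 : ∀ y, φ (φ' y) = y := fun y ↦ hinj' (by rw [hφ, hφ'])
  have hbij : Bijective φ := ⟨(LeftInverse.injective h1), RightInverse.surjective h2⟩
  have hiso := isIsometricImmersion_of_deviation_eq_zero hsmooth hdev
  have hiso' := isIsometricImmersion_of_deviation_eq_zero hsmooth' hdev'
  have hloc : IsLocalDiffeomorph 𝓘(ℝ, E4) (𝓡 4) ∞ Ψ' := hiso'.isLocalDiffeomorph rfl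
  have hcomp : Ψ' ∘ φ = Ψ := funext hφ
  have hjΨ : ContMDiff 𝓘(ℝ, E4) (𝓡 4) ∞ (Ψ' ∘ φ) := by rw [hcomp]; exact hsmooth
  have hφs : ContMDiff 𝓘(ℝ, E4) 𝓘(ℝ, E4) ∞ φ := contMDiff_of_comp_isLocalDiffeomorph hloc hinj' hjΨ
  refine ⟨φ, hbij, hφ, hφs, fun y ↦ ?_⟩
  have hpb' : pullbackBilin (I := 𝓡 4) (I' := 𝓘(ℝ, E4)) Ψ' 𝓢.metric.val =
      (Kerr.smoothMetric M' a' (Kerr.rPlus M' a')).toPseudoRiemannianMetric.val := funext hiso'.2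
  have hchain := pullbackBilin_comp (I := 𝓘(ℝ, E4)) (I' := 𝓘(ℝ, E4)) (I'' := 𝓡 4)
    (hiso'.1.mdifferentiable (by simp)) (hφs.mdifferentiable (by simp)) 𝓢.metric.val
  rw [hcomp, hpb'] at hchain
  rw [← congrFun hchain y]
  exact hiso.2 y

end Transition

/-! ### §4 The pulled-back stationary field and the first parameter relation `M/r₊ = M'/r₊'` -/

section Pullback

variable [Kerr.Facts] {M a M' a' : ℝ} {φ : Kerr.region a (Kerr.rPlus M a) → Kerr.region a' (Kerr.rPlus M' a')}

/-- **`φ^* ∂_{t*}'` is a Killing field of `g_{M,a}`** for an isometric immersion `φ : g_{M,a} → g_{M',a'}` of Kerr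
exteriors (Killing fields pull back under equidimensional isometric immersions, `IsKillingField.comap_mpullback`, and
`φ^* g_{M',a'}` IS `g_{M,a}`; `∂_{t*}'` is Killing by `Kerr.isKillingField_stationaryField_smoothMetric`). Adapted from
`SymplecticDualOfTheBomb.isKillingField_mpullback_killing`. [cite: ONeill1983, Ch. 9, Prop. 9.25] -/
theorem isKillingField_mpullback_stationaryField [(Kerr.smoothMetric M a (Kerr.rPlus M a)).HasLeviCivita]
    [(Kerr.smoothMetric M' a' (Kerr.rPlus M' a')).HasLeviCivita]
    (hφ : PseudoRiemannianMetric.IsIsometricImmersion (Kerr.smoothMetric M a (Kerr.rPlus M a)).toPseudoRiemannianMetric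
      (Kerr.smoothMetric M' a' (Kerr.rPlus M' a')).toPseudoRiemannianMetric φ) :
    (Kerr.smoothMetric M a (Kerr.rPlus M a)).toPseudoRiemannianMetric.IsKillingField
      (VectorField.mpullback 𝓘(ℝ, E4) 𝓘(ℝ, E4) φ (Kerr.stationaryField a' (Kerr.rPlus M' a'))) := by
  -- adapted from `isKillingField_mpullback_killing` (…KerrIsometryRigidityWave3)
  have hT := Kerr.isKillingField_stationaryField_smoothMetric M' a' (Kerr.rPlus M' a')
  set gc := (Kerr.smoothMetric M' a' (Kerr.rPlus M' a')).toPseudoRiemannianMetric.comap (I' := 𝓘(ℝ, E4))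
    (N := Kerr.region a (Kerr.rPlus M a)) PseudoRiemannianMetric.contMDiff_pullbackBilin_holds φ
    hφ.contMDiff_add_one hφ.injective_mfderiv rfl with hgc_def
  haveI hgcLC : gc.HasLeviCivita := gc.hasLeviCivita
  have hgc : (Kerr.smoothMetric M a (Kerr.rPlus M a)).toPseudoRiemannianMetric = gc :=
    PseudoRiemannianMetric.ext (funext fun y ↦ (hφ.2 y).symm)
  have key : gc.IsKillingField
      (VectorField.mpullback 𝓘(ℝ, E4) 𝓘(ℝ, E4) φ (Kerr.stationaryField a' (Kerr.rPlus M' a'))) :=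
    PseudoRiemannianMetric.IsKillingField.comap_mpullback (I' := 𝓘(ℝ, E4)) (N := Kerr.region a (Kerr.rPlus M a))
      (Kerr.smoothMetric M' a' (Kerr.rPlus M' a')).toPseudoRiemannianMetric
      PseudoRiemannianMetric.contMDiff_pullbackBilin_holds hφ.contMDiff_add_one hφ.injective_mfderiv rfl hT
  exact (PseudoRiemannianMetric.isKillingField_congr_metric hgc inferInstance hgcLC _).2 key

/-- **The norm of `φ^* ∂_{t*}'` is `−1 + 2H' ∘ φ`**: `g_{M,a}(Y, Y)(x) = g_{M',a'}(∂_{t*}, ∂_{t*})(φ x)` for `Y = φ^* ∂_{t*}'`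
(`φ^* g' = g`, `dφ Y = ∂_{t*}' ∘ φ`), and `g_{M',a'}(∂_{t*}, ∂_{t*}) = −1 + 2H'`. [cite: ONeill1983, Ch. 3, p. 58] -/
theorem val_mpullback_stationaryField
    (hφ : PseudoRiemannianMetric.IsIsometricImmersion (Kerr.smoothMetric M a (Kerr.rPlus M a)).toPseudoRiemannianMetric
      (Kerr.smoothMetric M' a' (Kerr.rPlus M' a')).toPseudoRiemannianMetric φ) (x : Kerr.region a (Kerr.rPlus M a)) :
    (Kerr.smoothMetric M a (Kerr.rPlus M a)).val x
        (VectorField.mpullback 𝓘(ℝ, E4) 𝓘(ℝ, E4) φ (Kerr.stationaryField a' (Kerr.rPlus M' a')) x)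
        (VectorField.mpullback 𝓘(ℝ, E4) 𝓘(ℝ, E4) φ (Kerr.stationaryField a' (Kerr.rPlus M' a')) x) =
      -1 + 2 * Kerr.scalarH M' a' (φ x).1 := by
  have h := DFunLike.congr_fun (DFunLike.congr_fun (hφ.2 x)
    (VectorField.mpullback 𝓘(ℝ, E4) 𝓘(ℝ, E4) φ (Kerr.stationaryField a' (Kerr.rPlus M' a')) x))
    (VectorField.mpullback 𝓘(ℝ, E4) 𝓘(ℝ, E4) φ (Kerr.stationaryField a' (Kerr.rPlus M' a')) x)
  rw [pullbackBilin_apply, PseudoRiemannianMetric.mfderiv_mpullback_apply (I := 𝓘(ℝ, E4)) (I' := 𝓘(ℝ, E4))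
    (M := Kerr.region a' (Kerr.rPlus M' a')) (N := Kerr.region a (Kerr.rPlus M a)) (Φ := φ) hφ.injective_mfderiv
    rfl] at h
  -- `g_{M',a'}(∂_{t*}, ∂_{t*}) = −1 + 2H'` (`ℓ₀ = 1`; landed as `TameCensorship.Negative.kerrBilin_e0_e0`, whose module
  -- imports the route file and is therefore not imported here)
  have hgtt : Kerr.bilin M' a' (φ x).1 (E4.basisVector 0) (E4.basisVector 0) = -1 + 2 * Kerr.scalarH M' a' (φ x).1 := by
    rw [Kerr.bilin_apply, Kerr.nullCovector_basisVector_zero, Minkowski.bilin_basisVector_zero]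
    ring
  rw [← hgtt]
  exact h.symm

/-- **First parameter relation: an isometric immersion of the rotating sub-extremal Kerr exterior `(M, a)`, `a ≠ 0`,
ONTO the sub-extremal Kerr exterior `(M', a')` forces `M/r₊ = M'/r₊'`.** The Killing field `Y = φ^* ∂_{t*}'` of
`g_{M,a}` has norm `−1 + 2H' ∘ φ < −1 + 2M'/r₊'`, so `Y = α ∂_{t*}` (`killingField_eq_smul_of_norm_le`) and
`α²(−1 + 2H) = −1 + 2H' ∘ φ` on the exterior; since both `H` and `H'` approach `0`, `α² = 1`, whence `H = H' ∘ φ`, and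
comparing the suprema `M/r₊`, `M'/r₊'` (`φ` onto) gives the claim. O'Neill 1995, Ch. 2 §2.4 and Ch. 3 Cor. 3.7.4.
[cite: ONeill1995, Ch. 3 §3.7, Cor. 3.7.4] -/
theorem div_rPlus_eq_of_isIsometricImmersion (ha : a ≠ 0) (hMa : Kerr.IsSubextremal M a)
    (hMa' : Kerr.IsSubextremal M' a')
    (hφ : PseudoRiemannianMetric.IsIsometricImmersion (Kerr.smoothMetric M a (Kerr.rPlus M a)).toPseudoRiemannianMetric
      (Kerr.smoothMetric M' a' (Kerr.rPlus M' a')).toPseudoRiemannianMetric φ) (hsurj : Surjective φ) :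
    M / Kerr.rPlus M a = M' / Kerr.rPlus M' a' := by
  haveI := (Kerr.smoothMetric M a (Kerr.rPlus M a)).toPseudoRiemannianMetric.hasLeviCivita
  haveI := (Kerr.smoothMetric M' a' (Kerr.rPlus M' a')).toPseudoRiemannianMetric.hasLeviCivita
  have hM := hMa.pos
  have hM' := hMa'.pos
  have hnorm := val_mpullback_stationaryField hφ
  have hB : ∀ x : Kerr.region a (Kerr.rPlus M a),
      (Kerr.smoothMetric M a (Kerr.rPlus M a)).val x
        (VectorField.mpullback 𝓘(ℝ, E4) 𝓘(ℝ, E4) φ (Kerr.stationaryField a' (Kerr.rPlus M' a')) x)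
        (VectorField.mpullback 𝓘(ℝ, E4) 𝓘(ℝ, E4) φ (Kerr.stationaryField a' (Kerr.rPlus M' a')) x) ≤
      -1 + 2 * (M' / Kerr.rPlus M' a') := fun x ↦ by
    rw [hnorm x]
    linarith [scalarH_lt_div_rPlus hM' (φ x).2]
  obtain ⟨α, hα⟩ := killingField_eq_smul_of_norm_le ha hMa (isKillingField_mpullback_stationaryField hφ) hB
  -- `α² (−1 + 2H x) = −1 + 2H'(φ x)`
  have key : ∀ x : Kerr.region a (Kerr.rPlus M a),
      α ^ 2 * (-1 + 2 * Kerr.scalarH M a x.1) = -1 + 2 * Kerr.scalarH M' a' (φ x).1 := fun x ↦ by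
    have h := hnorm x
    rw [hα x] at h
    exact (kerrSchild_gtt_smul M a α x).symm.trans h
  have hHpos : ∀ x : Kerr.region a (Kerr.rPlus M a), 0 < Kerr.scalarH M a x.1 := fun x ↦
    Kerr.scalarH_pos hM (Kerr.radius_pos_of_mem_region x.2)
  have hHpos' : ∀ y : Kerr.region a' (Kerr.rPlus M' a'), 0 < Kerr.scalarH M' a' y.1 := fun y ↦
    Kerr.scalarH_pos hM' (Kerr.radius_pos_of_mem_region y.2)
  -- `α² = 1`: both `H` and `H'` approach `0`
  have hα2 : α ^ 2 = 1 := by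
    by_contra hne
    rcases lt_or_gt_of_ne hne with hlt | hgt
    · -- `α² < 1`: `H' > (1 − α²)/2` on the (primed) exterior, impossible
      obtain ⟨y, hy, hHy⟩ := exists_mem_exterior_scalarH_lt (a := a') hM' (ε := (1 - α ^ 2) / 2) (by linarith)
      obtain ⟨x, hx⟩ := hsurj ⟨y, hy⟩
      have h := key x
      rw [hx] at h
      nlinarith [hHpos x, sq_nonneg α]
    · -- `α² > 1`: `H > (α² − 1)/(2α²)` on the exterior, impossible
      have hα0 : α ≠ 0 := by
        rintro rfl
        norm_num at hgt
      have h2pos : (0 : ℝ) < 2 * α ^ 2 := by positivity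
      have hεpos : 0 < (α ^ 2 - 1) / (2 * α ^ 2) := div_pos (by linarith) h2pos
      obtain ⟨x, hx, hHx⟩ := exists_mem_exterior_scalarH_lt (a := a) hM hεpos
      have h := key ⟨x, hx⟩
      have h3 : 2 * α ^ 2 * Kerr.scalarH M a x < α ^ 2 - 1 := by
        have h4 := mul_lt_mul_of_pos_left hHx h2pos
        have h5 : 2 * α ^ 2 * ((α ^ 2 - 1) / (2 * α ^ 2)) = α ^ 2 - 1 := by field_simp
        linarith
      nlinarith [hHpos' (φ ⟨x, hx⟩)]
  have hH : ∀ x : Kerr.region a (Kerr.rPlus M a), Kerr.scalarH M a x.1 = Kerr.scalarH M' a' (φ x).1 := fun x ↦ by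
    have h := key x
    rw [hα2] at h
    linarith
  refine le_antisymm (le_of_forall_pos_lt_add fun ε hε ↦ ?_) (le_of_forall_pos_lt_add fun ε hε ↦ ?_)
  · obtain ⟨x, hx, hHx⟩ := exists_mem_exterior_lt_scalarH (a := a) hM hε
    have h1 := scalarH_lt_div_rPlus hM' (φ ⟨x, hx⟩).2
    rw [← hH ⟨x, hx⟩] at h1
    linarith
  · obtain ⟨y, hy, hHy⟩ := exists_mem_exterior_lt_scalarH (a := a') hM' hε
    obtain ⟨x, hx⟩ := hsurj ⟨y, hy⟩
    have h1 := scalarH_lt_div_rPlus hM x.2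
    rw [hH x, hx] at h1
    linarith

end Pullback

/-- **First parameter relation for two exact Kerr charts of one region** (registered sub-goal of stub K♭, piece of
input (U)): if `O ⊆ 𝓢` is an exact Kerr `(M, a)` exterior with `a ≠ 0` and an exact Kerr `(M', a')` exterior, both
sub-extremal, then `M/r₊(M, a) = M'/r₊(M', a')` (transition isometry `exists_kerrChart_transition` +
`div_rPlus_eq_of_isIsometricImmersion`). [cite: ONeill1995, Ch. 3 §3.7, Cor. 3.7.4] -/
theorem div_rPlus_eq_of_isKerrDoc : ∀ (𝓢 : Spacetime.{0} 4) (O : Set 𝓢.carrier) (M a M' a' : ℝ), a ≠ 0 → Kerr.IsSubextremal M a → Kerr.IsSubextremal M' a' → IsKerrDoc 𝓢 O M a → IsKerrDoc 𝓢 O M' a' → M / Kerr.rPlus M a = M' / Kerr.rPlus M' a' := by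
  intro 𝓢 O M a M' a' ha hMa hMa' h h'
  haveI : Kerr.Facts := ⟨Kerr.isConnected_region_holds, Kerr.contMDiff_bilin_holds, Kerr.contMDiff_timeVector_holds⟩
  obtain ⟨Ψ, hinj, hsmooth, hrange, hdev, -⟩ := h
  obtain ⟨Ψ', hinj', hsmooth', hrange', hdev', -⟩ := h'
  obtain ⟨φ, hbij, -, hφ⟩ :=
    exists_kerrChart_transition hinj hsmooth hdev hinj' hsmooth' hdev' (hrange.trans hrange'.symm)
  exact div_rPlus_eq_of_isIsometricImmersion ha hMa hMa' hφ hbij.2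

end Summit.FinalStateConjecture.FinalStateConjecture.Theorems.TameLaSalle

end
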